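import Mathlib
import Summits.AtomisticToContinuum.HydrodynamicLimit.Theorems.ImplosionDichotomyDenseExcursionSonicSmoothBranchCkChar

/-!
# The smooth branch at the repulsive sonic point with a `C^k → C⁰` estimate, locally uniform in `Λ` (theorem T2, local form)
# (crux `DenseExcursion`, line `sonic-cavity-renewal`, brick for stub `stub_cavityResolventCk`)

Helper file (`--supports stmt-AtomisticToContinuum-12586`, line lead a2, stub-worker W4 for `stub_cavityResolventCk`).
THE FIRST MISSING THEOREM (T2) of the decomposition of `stub_cavityResolventCk`, in its local form
`sonic_smooth_branch_Ck_local` (registered): for a monatomic tube profile, `k : ℕ` and a bound `R` there are `δ > 0` and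
`K > 0` such that for every `Λ` with `‖Λ‖ ≤ R`, `Re ν(Λ) ≤ k − 1` (`ν = (b₊₊(0) − Λ)/κ`,
`b₊₊(0) = ⅔W′(0) + 2S′(0) + 2W(0) + 4S(0) − r`, `κ = −(W′ + S′)(0)`) and `|Im Λ| ≥ 1`, every `C^∞` source `(f, g)` and
every `q₀ : ℂ`, the resolvent equation `Λŵ − linW = f`, `Λŝ − linS = g` has a `C^∞` solution on `(−δ, δ)` with
`ŵ(0) − 3ŝ(0) = q₀` and `‖ŵ‖ + ‖ŝ‖ ≤ K(‖q₀‖ + sup_{[−δ,δ]} Σ_{j≤k}(‖f⁽ʲ⁾‖ + ‖g⁽ʲ⁾‖))`, unique among `C^∞` solutions with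
the same `q₀`. It is `sonic_char_branch` (file `…SonicSmoothBranchCkChar`) read through the characteristic fields
`p = ŵ + 3ŝ`, `q = ŵ − 3ŝ` (`mode_char_system` and its inverse, `lin_iff_char`). `K` depends on `R`: the majorant of the
Frobenius series grows with `|Λ|` (the phase `e^{Λx/c₋(0)}` of the regular family is expanded, not factored), so the
uniformity in `Im Λ → ∞` at fixed `δ` (needed only together with `Re Λ ≤ const`) is NOT asserted here. Sources: folklore.
-/

noncomputable section

open Set Filter
open scoped Topology ContDiff

namespace Summit.AtomisticToContinuum.HydrodynamicLimit.Theorems.SonicCavityRenewal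

open Summit.AtomisticToContinuum.HydrodynamicLimit.Theorems.R2OneModeTwoConditions

/-- THE RESOLVENT EQUATION IN CHARACTERISTIC FORM (pointwise algebra, both directions): `Λŵ − linW = f ∧ Λŝ − linS = g`
iff `c₊(ŵ′ + 3ŝ′) = (Λ − b₊₊)(ŵ + 3ŝ) − b₊₋(ŵ − 3ŝ) − (f + 3g) ∧ c₋(ŵ′ − 3ŝ′) = −b₋₊(ŵ + 3ŝ) + (Λ − b₋₋)(ŵ − 3ŝ) − (f − 3g)`.
[folklore] -/
theorem lin_iff_char (r : ℝ) (W S : ℝ → ℝ) (Λ : ℂ) (ŵ ŝ : ℝ → ℂ) (f g : ℂ) (x : ℝ) :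
    (Λ * ŵ x - linW r W S ŵ ŝ x = f ∧ Λ * ŝ x - linS r W S ŵ ŝ x = g) ↔
    (((W x - 1 + S x : ℝ) : ℂ) * (deriv ŵ x + 3 * deriv ŝ x) =
        (Λ - ((2 / 3 * deriv W x + 2 * W x - r + 2 * deriv S x + 4 * S x : ℝ) : ℂ)) * (ŵ x + 3 * ŝ x) -
          ((deriv W x / 3 + deriv S x + 2 * S x : ℝ) : ℂ) * (ŵ x - 3 * ŝ x) - (f + 3 * g) ∧
      ((W x - 1 - S x : ℝ) : ℂ) * (deriv ŵ x - 3 * deriv ŝ x) =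
        -((deriv W x / 3 - deriv S x - 2 * S x : ℝ) : ℂ) * (ŵ x + 3 * ŝ x) +
          (Λ - ((2 / 3 * deriv W x + 2 * W x - r - 2 * deriv S x - 4 * S x : ℝ) : ℂ)) * (ŵ x - 3 * ŝ x) - (f - 3 * g)) := by
  unfold linW linS
  push_cast
  constructor
  · rintro ⟨h1, h2⟩
    exact ⟨by linear_combination (-1 : ℂ) * h1 - 3 * h2, by linear_combination (-1 : ℂ) * h1 + 3 * h2⟩
  · rintro ⟨c1, c2⟩
    exact ⟨by linear_combination (-(1 : ℂ) / 2) * c1 - (1 / 2) * c2, by linear_combination (-(1 : ℂ) / 6) * c1 + (1 / 6) * c2⟩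

/-- **Registered helper `sonic_smooth_branch_Ck_local` (T2, local form): THE SMOOTH BRANCH AT THE REPULSIVE SONIC POINT
WITH A `C^k → C⁰` ESTIMATE, UNIFORM ON BOUNDED `Λ`-SETS, AND ITS UNIQUENESS.** See the module docstring. [folklore] -/
theorem sonic_smooth_branch_Ck_local : ∀ (r : ℝ) (W S : ℝ → ℝ), (17307 / 15625 : ℝ) ≤ r → r ≤ 89409 / 80000 → IsMonatomicProfile r W S → OrigProfileEqs r W S → CavityTube r W S → ∀ (k : ℕ) (R : ℝ), ∃ δ > 0, ∃ K > 0, ∀ Λ : ℂ, ‖Λ‖ ≤ R → ((((2 / 3 * deriv W 0 + 2 * deriv S 0 + 2 * W 0 + 4 * S 0 - r : ℝ) : ℂ) - Λ) / ((-(deriv W 0 + deriv S 0) : ℝ) : ℂ)).re ≤ (k : ℝ) - 1 → 1 ≤ |Λ.im| → ∀ (f g : ℝ → ℂ), ContDiff ℝ ∞ f → ContDiff ℝ ∞ g → ∀ q₀ : ℂ, (∃ ŵ ŝ : ℝ → ℂ, ContDiffOn ℝ ∞ ŵ (Set.Ioo (-δ) δ) ∧ ContDiffOn ℝ ∞ ŝ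 (Set.Ioo (-δ) δ) ∧ ŵ 0 - 3 * ŝ 0 = q₀ ∧ (∀ x ∈ Set.Ioo (-δ) δ, Λ * ŵ x - linW r W S ŵ ŝ x = f x ∧ Λ * ŝ x - linS r W S ŵ ŝ x = g x) ∧ ∀ x ∈ Set.Ioo (-δ) δ, ‖ŵ x‖ + ‖ŝ x‖ ≤ K * (‖q₀‖ + ⨆ y : Set.Icc (-δ) δ, ∑ j ∈ Finset.range (k + 1), (‖iteratedDeriv j f y‖ + ‖iteratedDeriv j g y‖))) ∧ (∀ ŵ ŝ ŵ' ŝ' : ℝ → ℂ, ContDiffOn ℝ ∞ ŵ (Set.Ioo (-δ) δ) → ContDiffOn ℝ ∞ ŝ (Set.Ioo (-δ) δ) → ContDiffOn ℝ ∞ ŵ' (Set.Ioo (-δ) δ) → ContDiffOn ℝ ∞ ŝ' (Set.Ioo (-δ) δ) → (∀ x ∈ Set.Ioo (-δ) δ, Λ * ŵ x - linW r W S ŵ ŝ x = f x ∧ Λ * ŝ x - linS r W S ŵ ŝ x = g x) → (∀ x ∈ Set.Ioo (-δ) δ, Λ * ŵ' x - linW r W S ŵ' ŝ' x = f x ∧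 Λ * ŝ' x - linS r W S ŵ' ŝ' x = g x) → ŵ 0 - 3 * ŝ 0 = ŵ' 0 - 3 * ŝ' 0 → Set.EqOn ŵ ŵ' (Set.Ioo (-δ) δ) ∧ Set.EqOn ŝ ŝ' (Set.Ioo (-δ) δ)) := by
  intro r W S _ _ hP _ hT k R
  obtain ⟨δ, hδ, -, K, hK, hmain⟩ := sonic_char_branch r W S hP hT k R
  refine ⟨δ, hδ, 3 * K, by positivity, fun Λ hΛ hν hΛi f g hf hg q₀ => ?_⟩
  have hU : IsOpen (Ioo (-δ) δ) := isOpen_Ioo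
  have h0U : (0 : ℝ) ∈ Ioo (-δ) δ := ⟨by linarith, hδ⟩
  have hσp : ContDiff ℝ ∞ (fun x => f x + 3 * g x) := hf.add (contDiff_const.mul hg)
  have hσq : ContDiff ℝ ∞ (fun x => f x - 3 * g x) := hf.sub (contDiff_const.mul hg)
  obtain ⟨hex, huniq⟩ := hmain Λ hΛ hν hΛi (fun x => f x + 3 * g x) (fun x => f x - 3 * g x) hσp hσq q₀
  have hdf : ∀ {φ : ℝ → ℂ}, ContDiffOn ℝ ∞ φ (Ioo (-δ) δ) → ∀ y ∈ Ioo (-δ) δ, HasDerivAt φ (deriv φ y) y :=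
    fun hφ y hy => ((hφ.differentiableOn (by simp)) y hy |>.differentiableAt (hU.mem_nhds hy)).hasDerivAt
  constructor
  · -- EXISTENCE
    obtain ⟨p, q, hp, hq, hq0, hpq, hbd⟩ := hex
    refine ⟨fun x => (p x + q x) / 2, fun x => (p x - q x) / 6, (hp.add hq).div_const _, (hp.sub hq).div_const _,
      by simp only; rw [hq0]; ring, fun x hx => ?_, fun x hx => ?_⟩
    · -- the equations, through the characteristic fields
      have dw : deriv (fun x => (p x + q x) / 2) x = (deriv p x + deriv q x) / 2 :=
        (((hdf hp x hx).add (hdf hq x hx)).div_const 2).deriv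
      have ds : deriv (fun x => (p x - q x) / 6) x = (deriv p x - deriv q x) / 6 :=
        (((hdf hp x hx).sub (hdf hq x hx)).div_const 6).deriv
      refine (lin_iff_char r W S Λ (fun x => (p x + q x) / 2) (fun x => (p x - q x) / 6) (f x) (g x) x).2 ?_
      rw [dw, ds]
      obtain ⟨e1, e2⟩ := hpq x hx
      constructor
      · have : (deriv p x + deriv q x) / 2 + 3 * ((deriv p x - deriv q x) / 6) = deriv p x := by ring
        rw [this]; linear_combination e1
      · have : (deriv p x + deriv q x) / 2 - 3 * ((deriv p x - deriv q x) / 6) = deriv q x := by ring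
        rw [this]; linear_combination e2
    · -- the estimate, through `sup Σ`
      set F : ℝ → ℝ := fun y => ∑ j ∈ Finset.range (k + 1), (‖iteratedDeriv j f y‖ + ‖iteratedDeriv j g y‖) with hF
      have hFc : Continuous F := continuous_finsetSum _ fun j _ =>
        ((hf.continuous_iteratedDeriv j (by exact_mod_cast le_top)).norm).add
          ((hg.continuous_iteratedDeriv j (by exact_mod_cast le_top)).norm)
      obtain ⟨B, hB⟩ := (isCompact_Icc (a := -δ) (b := δ)).exists_bound_of_continuousOn hFc.continuousOn
      have hbdd : BddAbove (range fun y : Icc (-δ) δ => F y) :=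
        ⟨B, by rintro _ ⟨y, rfl⟩; exact (le_abs_self _).trans ((Real.norm_eq_abs _).symm.le.trans (hB y y.2))⟩
      have hsub : Icc (-|x|) |x| ⊆ Icc (-δ) δ := fun y hy =>
        ⟨by linarith [hy.1, (abs_lt.2 hx).le], hy.2.trans (abs_lt.2 hx).le⟩
      have hM : ∀ y ∈ Icc (-|x|) |x|, ∀ j : ℕ, j ≤ k →
          ‖iteratedDeriv j (fun x => f x + 3 * g x) y‖ ≤ 3 * ⨆ y : Icc (-δ) δ, F y ∧
          ‖iteratedDeriv j (fun x => f x - 3 * g x) y‖ ≤ 3 * ⨆ y : Icc (-δ) δ, F y := by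
        intro y hy j hj
        have hfy : ContDiffAt ℝ j f y := hf.contDiffAt.of_le (by exact_mod_cast le_top)
        have hgy : ContDiffAt ℝ j g y := hg.contDiffAt.of_le (by exact_mod_cast le_top)
        have h3gy : ContDiffAt ℝ j (fun x => 3 * g x) y := contDiff_const.contDiffAt.mul hgy
        have hle : ‖iteratedDeriv j f y‖ + ‖iteratedDeriv j g y‖ ≤ ⨆ y : Icc (-δ) δ, F y := by
          have h1 : ‖iteratedDeriv j f y‖ + ‖iteratedDeriv j g y‖ ≤ F y :=
            Finset.single_le_sum (f := fun j => ‖iteratedDeriv j f y‖ + ‖iteratedDeriv j g y‖)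
              (fun i _ => by positivity) (Finset.mem_range.2 (Nat.lt_succ_of_le hj))
          exact h1.trans (le_ciSup hbdd ⟨y, hsub hy⟩)
        have h3 : iteratedDeriv j (fun x => 3 * g x) y = 3 * iteratedDeriv j g y := iteratedDeriv_const_mul 3 hgy
        constructor
        · rw [iteratedDeriv_fun_add hfy h3gy, h3]
          calc _ ≤ ‖iteratedDeriv j f y‖ + ‖3 * iteratedDeriv j g y‖ := norm_add_le _ _
            _ ≤ 3 * (‖iteratedDeriv j f y‖ + ‖iteratedDeriv j g y‖) := by
                rw [norm_mul, Complex.norm_ofNat]; nlinarith [norm_nonneg (iteratedDeriv j f y)]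
            _ ≤ _ := by gcongr
        · rw [iteratedDeriv_fun_sub hfy h3gy, h3]
          calc _ ≤ ‖iteratedDeriv j f y‖ + ‖3 * iteratedDeriv j g y‖ := norm_sub_le _ _
            _ ≤ 3 * (‖iteratedDeriv j f y‖ + ‖iteratedDeriv j g y‖) := by
                rw [norm_mul, Complex.norm_ofNat]; nlinarith [norm_nonneg (iteratedDeriv j f y)]
            _ ≤ _ := by gcongr
      have key := hbd x hx _ hM
      have hsup0 : 0 ≤ ⨆ y : Icc (-δ) δ, F y :=
        (Finset.sum_nonneg fun j _ => by positivity).trans (le_ciSup hbdd ⟨0, by constructor <;> linarith⟩)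
      calc ‖(p x + q x) / 2‖ + ‖(p x - q x) / 6‖ ≤ (‖p x‖ + ‖q x‖) / 2 + (‖p x‖ + ‖q x‖) / 6 := by
            rw [norm_div, norm_div, Complex.norm_ofNat, Complex.norm_ofNat]
            exact add_le_add (div_le_div_of_nonneg_right (norm_add_le _ _) zero_le_two)
              (div_le_div_of_nonneg_right (norm_sub_le _ _) (by norm_num))
        _ ≤ ‖p x‖ + ‖q x‖ := by nlinarith [norm_nonneg (p x), norm_nonneg (q x)]
        _ ≤ K * (‖q₀‖ + 3 * ⨆ y : Icc (-δ) δ, F y) := key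
        _ ≤ 3 * K * (‖q₀‖ + ⨆ y : Icc (-δ) δ, F y) := by nlinarith [norm_nonneg q₀]
  · -- UNIQUENESS
    intro ŵ ŝ ŵ' ŝ' hŵ hŝ hŵ' hŝ' h1 h2 hq
    have hchar : ∀ {u v : ℝ → ℂ}, ContDiffOn ℝ ∞ u (Ioo (-δ) δ) → ContDiffOn ℝ ∞ v (Ioo (-δ) δ) →
        (∀ x ∈ Ioo (-δ) δ, Λ * u x - linW r W S u v x = f x ∧ Λ * v x - linS r W S u v x = g x) →
        ∀ x ∈ Ioo (-δ) δ, ((W x - 1 + S x : ℝ) : ℂ) * deriv (fun y => u y + 3 * v y) x =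
          (Λ - ((2 / 3 * deriv W x + 2 * W x - r + 2 * deriv S x + 4 * S x : ℝ) : ℂ)) * (fun y => u y + 3 * v y) x -
            ((deriv W x / 3 + deriv S x + 2 * S x : ℝ) : ℂ) * (fun y => u y - 3 * v y) x - (fun x => f x + 3 * g x) x ∧
          ((W x - 1 - S x : ℝ) : ℂ) * deriv (fun y => u y - 3 * v y) x =
          -((deriv W x / 3 - deriv S x - 2 * S x : ℝ) : ℂ) * (fun y => u y + 3 * v y) x +
            (Λ - ((2 / 3 * deriv W x + 2 * W x - r - 2 * deriv S x - 4 * S x : ℝ) : ℂ)) * (fun y => u y - 3 * v y) x -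
              (fun x => f x - 3 * g x) x := by
      intro u v hu hv h x hx
      have dp : deriv (fun y => u y + 3 * v y) x = deriv u x + 3 * deriv v x :=
        ((hdf hu x hx).add ((hdf hv x hx).const_mul 3)).deriv
      have dq : deriv (fun y => u y - 3 * v y) x = deriv u x - 3 * deriv v x :=
        ((hdf hu x hx).sub ((hdf hv x hx).const_mul 3)).deriv
      rw [dp, dq]
      exact (lin_iff_char r W S Λ u v (f x) (g x) x).1 (h x hx)
    have key := huniq (fun y => ŵ y + 3 * ŝ y) (fun y => ŵ y - 3 * ŝ y) (fun y => ŵ' y + 3 * ŝ' y)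
      (fun y => ŵ' y - 3 * ŝ' y) (hŵ.add (contDiffOn_const.mul hŝ)) (hŵ.sub (contDiffOn_const.mul hŝ))
      (hŵ'.add (contDiffOn_const.mul hŝ')) (hŵ'.sub (contDiffOn_const.mul hŝ')) (hchar hŵ hŝ h1) (hchar hŵ' hŝ' h2) hq
    obtain ⟨kp, kq⟩ := key
    refine ⟨fun x hx => ?_, fun x hx => ?_⟩
    · have a := kp hx; have b := kq hx; beta_reduce at a b; linear_combination (1 / 2 : ℂ) * a + (1 / 2 : ℂ) * b
    · have a := kp hx; have b := kq hx; beta_reduce at a b; linear_combination (1 / 6 : ℂ) * a - (1 / 6 : ℂ) * b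

end Summit.AtomisticToContinuum.HydrodynamicLimit.Theorems.SonicCavityRenewal

end
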